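import Summits.MatrixMultiplication.MatrixMultiplication.Theorems.AbelianSTPPCensusShapeCertVQSemantics

/-!
# Abelian STPP census — soundness of `ShapeCertVQ` (part 2a: the static data is correct — kernel evaluations, first slices)

Cell mm-stpp, rung F-M1; successor kernel item VQ-CERT in support of the closed crux item stmt-MatrixMultiplication-19191; seat
mm-stpp-vp-p2 (gen 1).  Kernel evaluations (`decide +kernel`, no `native_decide`) certifying the data files `…ShapeCertVQData` /
`…ShapeCertVQCandA/B/C`: the gain table inequality `V⁵·10³⁶ ≤ gainQ(V)⁶` (`V ≤ 512`) and the table/listing checks `allOKQ` over the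
universe slices `a ≤ 5` of order `489` (the thin shapes — most of the 9319).  The remaining slices, the monotonicity checks and every
consequence used by the search are in `…ShapeCertVQTables`.  Split only to bound the kernel time of one file.
-/

set_option linter.dupNamespace false -- `MatrixMultiplication.MatrixMultiplication` (summit = problem, D-0017)
set_option autoImplicit false

namespace Summit.MatrixMultiplication.MatrixMultiplication.Theorems.ShapeCertVQ

open ShapeCert ShapeCertVP

section kernel_checks
/-! ### Kernel evaluations -/

/-- the gain table inequality `V⁵ · 10³⁶ ≤ gainQ(V)⁶` for `V ≤ 512` -/
theorem gainQ_pow_le : ∀ V ≤ 512, V ^ 5 * 1000000 ^ 6 ≤ gainQ V ^ 6 := by decide +kernel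

/-- data checks, universe slice `a = 1` -/
theorem allOKQ_s0 : ((univ0Q 489 0 1).all allOKQ) = true := by decide +kernel
/-- data checks, universe slice `a = 2` -/
theorem allOKQ_s1 : ((univ0Q 489 1 1).all allOKQ) = true := by decide +kernel
/-- data checks, universe slice `a = 3` -/
theorem allOKQ_s2 : ((univ0Q 489 2 1).all allOKQ) = true := by decide +kernel
/-- data checks, universe slice `a ∈ {4, 5}` -/
theorem allOKQ_s3 : ((univ0Q 489 3 2).all allOKQ) = true := by decide +kernel

end kernel_checks

end Summit.MatrixMultiplication.MatrixMultiplication.Theorems.ShapeCertVQ
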